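import Summits.QuantumFields.YangMills.Theorems.LocalInsertionInsertionStepOfConcentration
import Summits.QuantumFields.YangMills.Theorems.LocalInsertionMedianHeightOneOfMeanPlaquette
import HarnessLib

/-!
# Line «local_insertion» on crux `HistoryTailL` (stmt-QuantumFields-19936) — HEIGHT ONE BY NAME: K1 ∧ (EQ1) ∧ local goodness ⇒ the
# `stub_insertionHeightOne` integrand bound for every cut-off `K ≥ 3` and every `ε ≥ 0` (the median row DISCHARGED into the mean plaquette deviation)

Cell `ym3-torus` (YM ladder rung R3 = continuum SU(2) Yang–Mills on the three-torus — a RUNG, NOT the Clay problem: not d = 4, not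
infinite volume, not a mass gap), width seat `ym-ust-19936-w3` gen 11, `--supports stmt-QuantumFields-19936 --as helper`; by-name layer (route
cone).  THEOREMS ONLY, definition-free.  HONEST FRAMING: CONDITIONAL — the three hypotheses `MesoscopicConcentrationL` (stmt-23532), (EQ1) «mean
bare plaquette deviation at the Gaussian scale, `∫ dist1 U(∂p) ∂Gibbs_K ≤ C₁·√(γL^{−K})`, uniformly in `K` and `γ`» (an equipartition-type
upper bound; the tree has it only with a `√(log β)` loss) and the height-one local goodness family are NOT in the tree.  Nothing of
`LocalInsertionL` (23607), the registered stubs, the crux `HistoryTailL` or any summit statement is proved.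

★★★`insertionHeightOneInterior_of_concentration_meanPlaquette`: 23532 ∧ (EQ1) ∧ ⟨goodness at height one⟩ ⇒ for every `L`, every `ε ≥ 0`,
every profile `(b₀, p₀)`: a `K`-, plaquette-uniform `M₀` and `γ₁` with `∫_{G(a,1)} exp(ε·min(dist1(Ū¹(∂a))/g_{K−1}, p(g_{K−1}))) ∂Gibbs_K ≤ M₀`
for all `1 ≤ j ≤ 1`, `j + 2 ≤ K` — the registered stub `stub_insertionHeightOne` (`Cruxes/HistoryTailL/Lines/local_insertion.lean` 48f0ac19)
has `j ≤ K`; the cut-offs `K ∈ {1, 2}` are not covered.  Assembly: K2 at `j = 1` is ✓`stub_levelOneLipschitz` (p674322), the median row is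
✓`MedianHeightOne.median_heightOne_of_meanPlaquette` (comb gauge + ladders + (EQ1) + Markov), then ✓`InsertionStepOfConcentration.insertion_step`.
So, by kernel: AT HEIGHT ONE THE ORGAN CONTENT OF LINE #13 IS «massless-rate concentration (K1) + the mean plaquette deviation at scale g_K
(EQ1) + local goodness», nothing else. [cite: Balaban1985UV3, (3) p.256, (7) p.257 and (71) p.273]
-/

set_option autoImplicit false

noncomputable section

open scoped BigOperators
open MeasureTheory
open Literature.MathematicalPhysics.QuantumFieldTheory.Balaban1983to89
open Literature.MathematicalPhysics.QuantumFieldTheory.Balaban1983to89.T3ContinuumYM3Torus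
open Literature.MathematicalPhysics.QuantumFieldTheory.Balaban1983to89.T3UnitScaleTilt
open Literature.MathematicalPhysics.QuantumFieldTheory.Balaban1983to89.T3UnitLawDensityEML
open Summit.QuantumFields.YangMills.Theorems.LocalInsertion.InsertionStepOfConcentration (insertion_step)
open Summit.QuantumFields.YangMills.Theorems.LocalInsertion.MedianHeightOne (median_heightOne_of_meanPlaquette)

namespace Summit.QuantumFields.YangMills.Theorems.LocalInsertion.InsertionHeightOneOfMeanPlaquette

/-- **HEIGHT ONE FROM K1 ∧ (EQ1) ∧ LOCAL GOODNESS, BY NAME.**  See the module docstring.  `M₀` is ✓`insertion_step`'s bound at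
`m = 36(CL+1)(C₁+1)(17L)⁴/L`; `γ₁ = min(γ_{K1}, γ_{K2}(b₀,p₀), γ_{EQ1}, γ_{good}(b₀,p₀), ½)`.  CONDITIONAL; nothing of the stubs∕cruxes proved.
[cite: Balaban1985UV3, (7) p.257 and (71) p.273] -/
theorem insertionHeightOneInterior_of_concentration_meanPlaquette
    (hK1 : Summit.QuantumFields.YangMills.Theses.PoincareLipschitz.MesoscopicConcentrationL)
    (hEQ1 : ∀ (L : ℕ), ∃ C₁ : ℝ, 0 ≤ C₁ ∧ ∃ γ₁ : ℝ, 0 < γ₁ ∧ γ₁ ≤ 1 ∧ ∀ (F : T3Family) (γ : ℝ), F.L = L → 0 < γ → γ ≤ γ₁ → ∀ (K : ℕ) (p : Plaq (F.P K) 0), ∫ U, GaugeGroup.dist1 (GaugeField.plaqHol U p) ∂(gibbsK F ℰp γ K) ≤ C₁ * Real.sqrt (γ * ((F.L : ℝ)⁻¹) ^ K))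
    (hGood : ∀ (L : ℕ) (b₀ p₀ : ℝ), 0 < b₀ → 2 < p₀ → ∃ γ₁ : ℝ, 0 < γ₁ ∧ γ₁ ≤ 1 ∧ ∀ (F : T3Family) (γ : ℝ), F.L = L → 0 < γ → γ ≤ γ₁ → ∀ (K j : ℕ), 1 ≤ j → j + 2 ≤ K → j ≤ 1 → ∀ (a : Plaq (F.P K) j), (gibbsK F ℰp γ K).real {U : GaugeField (F.P K) 0 (Matrix.specialUnitaryGroup (Fin 2) ℂ) | (∀ (i : ℕ) (q : Plaq (F.P K) i), i < j → Site.tdist (fun k => ((((q.src k).val * F.L ^ i : ℕ)) : ZMod ((F.P K).sitesPerDir 0))) (fun k => ((((a.src k).val * F.L ^ j : ℕ)) : ZMod ((F.P K).sitesPerDir 0))) + 64 * F.L ^ i ≤ 64 * F.L ^ j → GaugeGroup.dist1 (GaugeField.plaqHol (Averaging.iter (fun i' => BlockAveraging.blockAvg (P := F.P K) (j := i') ℰp) i U) q) < θBal F.L γ b₀ p₀ (K - i))}ᶜ ≤ 1 / 4) :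
    ∀ (L : ℕ) (ε : ℝ), 0 ≤ ε → ∀ (b₀ p₀ : ℝ), 0 < b₀ → 2 < p₀ → ∃ M₀ : ℝ, 0 ≤ M₀ ∧ ∃ γ₁ : ℝ, 0 < γ₁ ∧ γ₁ ≤ 1 ∧ ∀ (F : T3Family) (γ : ℝ), F.L = L → 0 < γ → γ ≤ γ₁ → ∀ (K j : ℕ), 1 ≤ j → j + 2 ≤ K → j ≤ 1 → ∀ (a : Plaq (F.P K) j), ∫ U in {U : GaugeField (F.P K) 0 (Matrix.specialUnitaryGroup (Fin 2) ℂ) | (∀ (i : ℕ) (q : Plaq (F.P K) i), i < j → Site.tdist (fun k => ((((q.src k).val * F.L ^ i : ℕ)) : ZMod ((F.P K).sitesPerDir 0))) (fun k => ((((a.src k).val * F.L ^ j : ℕ)) : ZMod ((F.P K).sitesPerDir 0))) + 64 * F.L ^ i ≤ 64 * F.L ^ j → GaugeGroup.dist1 (GaugeField.plaqHol (Averaging.iter (fun i' => BlockAveraging.blockAvg (P := F.P K) (j := i') ℰp) i U) q) < θBal F.L γ b₀ p₀ (K - i))}, Real.exp (ε * min (GaugeGroup.dist1 (GaugeField.plaqHol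 (Averaging.iter (fun i' => BlockAveraging.blockAvg (P := F.P K) (j := i') ℰp) j U) a) / Real.sqrt (γ * ((F.L : ℝ)⁻¹) ^ (K - j))) (B10.pFun b₀ p₀ (Real.sqrt (γ * ((F.L : ℝ)⁻¹) ^ (K - j))))) ∂(gibbsK F ℰp γ K) ≤ M₀ := by
  intro L ε hε b₀ p₀ hb₀ hp₀
  obtain ⟨Cc, cc, hCc, hcc, γa, hγa, hγa1, H1⟩ := hK1 L
  obtain ⟨CL, hCL, H2⟩ := Summit.QuantumFields.YangMills.Theorems.PoincareLipschitzLevelOneLipschitz.stub_levelOneLipschitz L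
  obtain ⟨γb, hγb, hγb1, H2'⟩ := H2 b₀ p₀ hb₀ hp₀
  obtain ⟨C₁, hC₁, γc, hγc, hγc1, HE⟩ := hEQ1 L
  obtain ⟨γd, hγd, hγd1, HG⟩ := hGood L b₀ p₀ hb₀ hp₀
  refine ⟨(2 * (36 * (CL + 1) * (C₁ + 1) * (17 * (L : ℝ)) ^ 4 / L + (CL + 1) * Real.sqrt (578 * Cc / cc)) + 1) * Real.exp (ε * (2 * (36 * (CL + 1) * (C₁ + 1) * (17 * (L : ℝ)) ^ 4 / L + (CL + 1) * Real.sqrt (578 * Cc / cc)) + 1)) + 2 * Cc * Real.exp (ε + (ε + 1) ^ 2 / (4 * (cc / (1156 * (CL + 1) ^ 2)))), ?_, min (min γa γb) (min (min γc γd) (1 / 2)),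
    lt_min (lt_min hγa hγb) (lt_min (lt_min hγc hγd) (by norm_num)),
    (min_le_left _ _).trans ((min_le_left _ _).trans hγa1), ?_⟩
  · have h1 : 0 ≤ 36 * (CL + 1) * (C₁ + 1) * (17 * (L : ℝ)) ^ 4 / L := by positivity
    exact Summit.QuantumFields.YangMills.Theorems.LocalInsertion.InsertionStepOfConcentration.insertionBound_nonneg ε hCc hCL h1
  intro F γ hFL hγ hγle K j hj hjK hj1 a
  obtain rfl : j = 1 := le_antisymm hj1 hj
  have hγa' : γ ≤ γa := hγle.trans ((min_le_left _ _).trans (min_le_left _ _))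
  have hγb' : γ ≤ γb := hγle.trans ((min_le_left _ _).trans (min_le_right _ _))
  have hγc' : γ ≤ γc := hγle.trans ((min_le_right _ _).trans ((min_le_left _ _).trans (min_le_left _ _)))
  have hγd' : γ ≤ γd := hγle.trans ((min_le_right _ _).trans ((min_le_left _ _).trans (min_le_right _ _)))
  have hγ2 : γ ≤ 1 / 2 := hγle.trans ((min_le_right _ _).trans (min_le_right _ _))
  have hγ1 : γ ≤ 1 := hγa'.trans hγa1
  have hK3 : 3 ≤ K := by omega
  have hm : (0 : ℝ) ≤ 36 * (CL + 1) * (C₁ + 1) * (17 * (F.L : ℝ)) ^ 4 / F.L := by positivity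
  have hMed := median_heightOne_of_meanPlaquette F hγ hγ1 hb₀ hK3 a hCL hC₁ (H2' F γ hFL hγ hγb' K 1 le_rfl hjK le_rfl a)
    (fun p => HE F γ hFL hγ hγc' K p) (HG F γ hFL hγ hγd' K 1 le_rfl hjK le_rfl a)
  have h := insertion_step F hγ hγ2 hε hjK a hCc hcc hCL hm (H1 F γ hFL hγ hγa' K) (H2' F γ hFL hγ hγb' K 1 le_rfl hjK le_rfl a) hMed
  rw [← hFL]
  exact h
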